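import Literature.Barriers.HodgeConjecture.GeneralizedHodgeTrivialReasonsSubHodgeOfFacts
import Literature.AlgebraicGeometry.Resolution.ProjectiveResolutionProofs
import Literature.AlgebraicGeometry.HodgeTheory.ComplexConjugationHolds
import Literature.AlgebraicGeometry.HodgeTheory.HodgeFiltrationModelsReductionProofs
import HarnessLib

/-!
# Grothendieck (1969), p. 300 — "`Filt'ᵖ ⊗ ℂ` is a sub-Hodge structure": the named fact from its TWO remaining named leaves

Companion (one theorem; no definition, no named fact, no `sorry`) of
`GeneralizedHodgeTrivialReasonsSubHodge` (the named fact
`Grothendieck1969_supportedClasses_isSubHodge`) and of `…SubHodgeOfFacts`, whose theorem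
`Grothendieck1969_supportedClasses_isSubHodge_of_deRham` derives the fact along Grothendieck's
printed line (p. 300: Gysin images of desingularizations of closed subschemes are compatible with
Hodge structures) from FIVE named facts of the tree: Deligne's description of `Filt'` (`hD`, Hodge
III Cor. 8.2.8), Hironaka (`hH`), Hodge models (`hM`), the independence of `H^{p,q}` from the model
(`hI`) and de Rham's theorem in multiplicative form (`hdR`).

Fact-decomposition record (librarian, fact-decompose, 2026-08-16; the fact ran to the prover budget
cap as an XL fact): three of those five leaves are by now DISCHARGED in the tree —
`Literature.AlgebraicGeometry.Resolution.Hironaka1964_projective_holds` (`ProjectiveResolutionProofs`: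
Kollár 2007 Thm. 3.27 from the proved principalization chain), `nonempty_hodgeModel_holds`
(`ComplexConjugationHolds`) and `hodgePQ_independent_of_hodgeModel_holds`
(`HodgeFiltrationModelsReductionProofs`) — so the residual trust base of
`Grothendieck1969_supportedClasses_isSubHodge_holds` is exactly TWO existing named facts:

* `Literature.AlgebraicGeometry.HodgeTheory.Deligne1974_ker_restrictCompl_eq_iSup_range_complexGysin`
  (Deligne, Hodge III Cor. 8.2.8 on the tree's carriers: `ker(Hⁱ(X) → Hⁱ(X ∖ Z))` is the sum of the
  Gysin images of resolutions of the components of `Z`; reduced in `GysinKernelWeights` to the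
  mixed Hodge structure of a pair), and
* `Literature.NumberTheory.Transcendental.exists_deRhamIsoFamily 𝓘(ℝ, E)` for every
  finite-dimensional complex normed `E` (de Rham's theorem with a MULTIPLICATIVE natural
  comparison; the natural normalized family is proved, `exists_isNatural_deRhamIsoFamily`, and the
  fact is reduced to the multiplicativity of the integration family,
  `exists_deRhamIsoFamily_of_isMultiplicative`, `DeRhamTheoremProofs`).

The theorem `Grothendieck1969_supportedClasses_isSubHodge_holds_of` records this in the canonical
shape `Child₁ → Child₂ → Parent`; no new named fact is introduced.

## References

* [GrothendieckTopology1969] A. Grothendieck, *Hodge's general conjecture is false for trivial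
  reasons*, Topology 8 (1969) 299–303, p. 300 and footnote †.
* [DeligneHodgeIII1974] P. Deligne, Théorie de Hodge III, Publ. Math. IHÉS 44 (1974), Cor. 8.2.8.
* [VoisinHodgeI2002] C. Voisin, Hodge Theory and Complex Algebraic Geometry I, §7.3.2, Lemma 7.30.
* [Kollar2007] J. Kollár, Lectures on Resolution of Singularities, Thm. 3.27.
-/

noncomputable section

open scoped Manifold

namespace Literature.Barriers.HodgeConjecture

open Literature.AlgebraicGeometry.HodgeTheory Literature.AlgebraicGeometry.Motives
open Literature.AlgebraicGeometry.Resolution (Hironaka1964_projective_holds)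
open Literature.NumberTheory.Transcendental (exists_deRhamIsoFamily)

/-- **`Grothendieck1969_supportedClasses_isSubHodge` from its two remaining named leaves**
(fact-decomposition glue, canonical name): Deligne's Gysin description of `Filt'` (`hD`) and de
Rham's theorem in multiplicative form (`hdR`); Hironaka's theorem, the existence of Hodge models and
the model-independence of `H^{p,q}` are supplied by their discharges
`Hironaka1964_projective_holds`, `nonempty_hodgeModel_holds`, `hodgePQ_independent_of_hodgeModel_holds`.
This is `Grothendieck1969_supportedClasses_isSubHodge_of_deRham` (`…SubHodgeOfFacts`) so fed.
[cite: GrothendieckTopology1969, p. 300 and footnote †] [cite: DeligneHodgeIII1974, Cor. 8.2.8]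
[cite: VoisinHodgeI2002, §7.3.2 (with Lemma 7.30)] -/
theorem Grothendieck1969_supportedClasses_isSubHodge_holds_of
    (hD : Deligne1974_ker_restrictCompl_eq_iSup_range_complexGysin)
    (hdR : ∀ (E : Type) [NormedAddCommGroup E] [NormedSpace ℂ E] [FiniteDimensional ℂ E],
      exists_deRhamIsoFamily 𝓘(ℝ, E)) :
    Grothendieck1969_supportedClasses_isSubHodge :=
  Grothendieck1969_supportedClasses_isSubHodge_of_deRham hD Hironaka1964_projective_holds
    (fun _ _ ↦ nonempty_hodgeModel_holds) hodgePQ_independent_of_hodgeModel_holds hdR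

end Literature.Barriers.HodgeConjecture

end
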